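import Literature.Computability.FineGrained.DiscreteFrechetReductionProgram
import Literature.Computability.FineGrained.OVFromSETHSplitInstance
import Literature.Computability.FineGrained.SETHHardnessProofs
import HarnessLib

/-!
# SETH-hardness of the discrete Fréchet distance: the run of Bringmann's reduction on the word RAM (proof of fine-grained.S15, discrete Fréchet)

The proof of the named fact `not_discreteFrechetDecision_inTimeO_of_sethWordRAM` of
`…FineGrained.SETHHardness` (K. Bringmann, FOCS 2014, Thm. 1.1, discrete case: assuming word-RAM
SETH, the discrete Fréchet decision problem has no `O(n^{2-ε})` algorithm). Its machine-level
content is Bringmann's reduction read on the word RAM (§3.1, "Proof of Thm. 1.1, discrete case"),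
proved here as the theorem `kSATInRAMTime_of_discreteFrechetDecision_inTimeO`: if the discrete
Fréchet decision problem has a deterministic `O(n^{2-ε})`-time word-RAM algorithm (`0 < ε ≤ 1`),
then for every width `k` and every `δ > 1 - ε/2`, `k`-SAT is decided in word-RAM time `O(2^{δ n})`
(`KSATInRAMTime k δ`; the paper's `O(M² 2^{(1-δ/2)N})` CNF-SAT algorithm, the polynomial factors
being absorbed by the exponent since `k`-CNFs without repeated clauses have
`M ≤ (2(N+1))^{k+1}` clauses, `numClauses_le_of_nodup`). With the build of
`…DiscreteFrechetReductionProgram` in hand, this file supplies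

* **the run** (`Params.reduction_outputsWithin`): the emulator's side conditions for the
  reduction's layout (`Params.envOK`), the target invariant and the agreement of the emulated
  memory with the initial memory of the Fréchet program on Bringmann's instance at the end of the
  build (`Params.tinv_finMem`, `Params.agree_finMem`), the read-out (`Params.post_spec`), whence,
  by `SProg.outputsWithin_withSubrun`, the reduction program outputs the decider's answer bit —
  `[1]` iff `φ` is satisfiable, by `FrechetRed.good_frechetInstance_iff` — within
  `Tpre + 38 T + 4` steps;
* **the word size** (`Params.kfit`, `Params.fits`): at `W = kfit · (n + inputWidth x)` everything
  fits; and the emulated word size is the decider's own (`Params.inputWidth_y`: the input width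
  of the emulated input is the bit size of `max |y| 9·10⁶`);
* **the time** (`Params.Tpre_le`, `Params.Ttotal_real_le`): the build is
  `O((Lx + 2)² (N₁ + N₂)) = poly(n) · 2^{n/2}` and the emulated run costs
  `38 (C (|P₁| + |P₂|)^{2-ε} + C) = poly(n) · 2^{(1-ε/2) n}`, both `O(2^{δ n})` for
  `δ > 1 - ε/2` since `k`-CNFs without repeated clauses have `poly(n)` clauses
  (`numClauses_le_of_nodup`);
* **the theorem** `kSATInRAMTime_of_discreteFrechetDecision_inTimeO` and the discharge
  `not_discreteFrechetDecision_inTimeO_of_sethWordRAM_holds` (shrink `ε` below `1`, take the width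
  `k` that word-RAM SETH provides at `ε/4`, run the reduction at `δ = 1 - ε/4 > 1 - ε/2`).

## References

* K. Bringmann, *Why walking the dog takes time: Fréchet distance has no strongly subquadratic
  algorithms unless SETH fails*, FOCS 2014 (arXiv:1404.1448), §3.1 and Thm. 1.1.
* V. Vassilevska Williams, *On some fine-grained questions in algorithms and complexity*,
  Proc. ICM 2018, §2.
-/

namespace Literature.Computability.FineGrained

open Cryptography Cryptography.WordRAM Complexity Cryptography.WordRAM.SProg

namespace FrechetRed

namespace Params

variable (g : Params) {W : ℕ} {O : List ℕ → List ℕ}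

/-! ### The emulated run -/

/-- The emulator's side conditions hold for the reduction's layout and environment. [folklore] -/
theorem envOK (hF : g.Fits W) : EnvOK lay g.env W := by
  obtain ⟨hX, hXLx, hBv, hSv, htop, hLyV, hPwV, hcMV, hmLx, hL₁, hL₂, hLy, hN₁, hN₂, hPw1, hn,
    hn₁₂, hnW, h16, hNN, hPwW, hNL₁, hNL₂, hWW⟩ := g.facts hF
  refine ⟨by decide, by decide, by decide, by decide, by decide, by decide, by decide,
    fun r hr => ?_, Or.inl ?_, ?_, ?_, hF.ws_lt.le⟩
  · simp only [lay, Layout.regs, List.mem_cons, List.not_mem_nil, or_false] at hr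
    show r < g.Bv ∧ r < g.Sv
    rcases hr with rfl | rfl | rfl | rfl | rfl | rfl | rfl <;> omega
  · show g.Bv + (g.V + 1) ≤ g.Sv; omega
  · show g.Bv + (g.V + 1) ≤ 2 ^ W; omega
  · show g.Sv + (g.V + 1) ≤ 2 ^ W; omega

/-- Every cell of the final memory is below `2 ^ W`. [folklore] -/
theorem finMem_lt (hF : g.Fits W) (a : ℕ) : g.finMem a < 2 ^ W := by
  obtain ⟨hX, hXLx, hBv, hSv, htop, hLyV, hPwV, hcMV, hmLx, hL₁, hL₂, hLy, hN₁, hN₂, hPw1, hn,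
    hn₁₂, hnW, h16, hNN, hPwW, hNL₁, hNL₂, hWW⟩ := g.facts hF
  unfold finMem
  by_cases ha : a < 100
  · rw [if_pos ha]; split_ifs <;> omega
  rw [if_neg ha]
  unfold finData
  by_cases hb : a < g.Bv
  · rw [dataW_of_lt _ _ hb]
    exact lt_of_le_of_lt (CliqueRed.relocated_le_of_forall (B := 2 ^ W - 1)
      (fun v hv => Nat.le_sub_one_of_lt (hF.input v hv)) (by omega)) (by omega)
  · exact (g.dataW_lt_Pw _ (not_lt.1 hb)).trans hPwW

/-- **The target invariant at the end of the build.** [folklore] -/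
theorem tinv_finMem (hF : g.Fits W) : TInv lay g.env (2 ^ W - 1) g.finMem := by
  obtain ⟨hX, hXLx, hBv, hSv, htop, hLyV, hPwV, hcMV, hmLx, hL₁, hL₂, hLy, hN₁, hN₂, hPw1, hn,
    hn₁₂, hnW, h16, hNN, hPwW, hNL₁, hNL₂, hWW⟩ := g.facts hF
  have hlen : (g.Ly :: g.y).length = g.Ly + 1 := by rw [List.length_cons, length_y]
  refine ⟨⟨?_, ?_, ?_, ?_⟩, fun a _ => ?_, fun a => Nat.le_sub_one_of_lt (g.finMem_lt hF a)⟩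
  · show g.finMem 10 = g.Bv; simp [finMem]
  · show g.finMem 11 = g.Sv; simp [finMem]
  · show g.finMem 12 = 0; simp [finMem]
  · show g.finMem 13 = 2 ^ g.ws; simp [finMem]; rfl
  · show g.finMem (g.Sv + a) ≤ 0
    unfold finMem finData
    rw [if_neg (by omega), dataW_of_le _ _ (by rw [hlen]; omega)]

/-- **The emulated input is in place at the end of the build**: below the region size, the
emulated memory is the initial memory of the Fréchet program on `y` at word size `ws`. [folklore] -/
theorem agree_finMem (hF : g.Fits W) : Agree g.env g.finMem (init g.ws g.y).mem := by
  obtain ⟨hX, hXLx, hBv, hSv, htop, hLyV, hPwV, hcMV, hmLx, hL₁, hL₂, hLy, hN₁, hN₂, hPw1, hn,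
    hn₁₂, hnW, h16, hNN, hPwW, hNL₁, hNL₂, hWW⟩ := g.facts hF
  have hlen : (g.Ly :: g.y).length = g.Ly + 1 := by rw [List.length_cons, length_y]
  have hly := g.length_y
  intro a _
  have hstamp : g.finMem (g.Sv + a) = 0 := by
    unfold finMem finData
    rw [if_neg (by omega), dataW_of_le _ _ (by rw [hlen]; omega)]
  show (if g.finMem (g.Sv + a) = 0 then g.finMem (g.Bv + a) else 0) = (init g.ws g.y).mem a
  rw [if_pos hstamp]
  unfold finMem finData dataW
  rw [if_neg (by omega), if_neg (by omega), Nat.add_sub_cancel_left, hlen]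
  rcases Nat.lt_or_ge a (g.Ly + 1) with ha | ha
  · rw [if_pos ha]
    rcases Nat.eq_zero_or_pos a with rfl | hpos
    · rw [init_mem_zero, hly]; rfl
    · obtain ⟨j, rfl⟩ := Nat.exists_eq_add_of_le' hpos
      rw [init_mem_succ _ _ _ (by omega), List.getD_cons_succ, List.getD_eq_getElem _ _ (by omega)]
      rfl
  · rw [if_neg (by omega), init_mem_of_length_lt _ _ _ (by omega)]

/-- **The read-out.** From any memory agreeing with the halting memory `dm` of the Fréchet program
(target invariant kept), `post` outputs `[dm 1]` in `3` steps. [folklore] -/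
theorem post_spec (hF : g.Fits W) {m₂ dm : ℕ → ℕ} (hag : Agree g.env m₂ dm)
    (hI : TInv lay g.env (2 ^ W - 1) m₂) (qs : List (List ℕ)) :
    ∃ (st₃ : Store) (t₃ : ℕ), t₃ ≤ 3 ∧ Exec W O CliqueRed.post ⟨m₂, qs⟩ st₃ t₃ ∧
      readOut st₃.mem = [dm 1] := by
  obtain ⟨hX, hXLx, hBv, hSv, htop, hLyV, hPwV, hcMV, hmLx, hL₁, hL₂, hLy, hN₁, hN₂, hPw1, hn,
    hn₁₂, hnW, h16, hNN, hPwW, hNL₁, hNL₂, hWW⟩ := g.facts hF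
  have h10 : m₂ 10 = g.Bv := hI.env.1
  have hst : m₂ (g.Sv + 1) = 0 := Nat.le_zero.1 (hI.stamp 1 (by show 1 < g.V + 1; omega))
  have h1 : m₂ (g.Bv + 1) = dm 1 := by
    have := hag 1 (by show 1 < g.V + 1; omega)
    simp only [edec, Params.env, hst, if_true] at this
    exact this
  refine ⟨_, 3, le_rfl, Exec.block _ m₂ qs, ?_⟩
  have hm : execOps W m₂ [(.add, CliqueRed.r 17, CliqueRed.r 10, CliqueRed.im 1),
      (.band, CliqueRed.r 1, CliqueRed.pt 17, CliqueRed.pt 17),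
      (.band, CliqueRed.r 0, CliqueRed.im 1, CliqueRed.im 1)] =
      Function.update (Function.update (Function.update m₂ 17 (g.Bv + 1)) 1 (dm 1)) 0 1 := by
    simp (disch := first | omega | decide) only [execOps_cons, execOps_nil, execOp, Operand.write,
      Operand.read, Function.update_self, Function.update_of_ne, h10, BinOp.eval_add_of_lt,
      BinOp.eval_band, Nat.and_self]
    rw [h1]
  show readOut (execOps W m₂ _) = _
  rw [hm]
  simp [readOut, readSeg, Function.update_self, Function.update_of_ne]

/-- **The reduction program's output.** At a word size `W` with `g.Fits W`, if the deterministic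
oracle-free Fréchet program `M` (largest constant `cM`) outputs `[bit]` on the emulated input `y`
at word size `ws` within `T` steps, then the reduction program outputs `[bit]` on
`x = encodeCNFWords φ` within `Tpre + 38 T + 4` steps. [folklore] -/
theorem reduction_outputsWithin (hF : g.Fits W) {M : Program} (hdet : M.IsDeterministic)
    (hof : M.IsOracleFree) (hcM : M.maxConst = g.cM) {T bit : ℕ}
    (hM : OutputsWithin M g.ws noOracle zeroCoins g.y [bit] T) :
    OutputsWithin (withSubrun (pre g.kF g.cM) lay M CliqueRed.post) W noOracle zeroCoins g.x [bit]
      (g.Ttotal T) := by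
  obtain ⟨hX, hXLx, hBv, hSv, htop, hLyV, hPwV, hcMV, hmLx, hL₁, hL₂, hLy, hN₁, hN₂, hPw1, hn,
    hn₁₂, hnW, h16, hNN, hPwW, hNL₁, hNL₂, hWW⟩ := g.facts hF
  have hW1 : 1 ≤ W := by have := hF.ws_lt; omega
  have h2W : 2 ≤ 2 ^ W := by
    calc (2 : ℕ) = 2 ^ 1 := rfl
      _ ≤ 2 ^ W := Nat.pow_le_pow_right (by norm_num) hW1
  obtain ⟨st₁, t₁, ht₁, hexec, hmem, hqs⟩ := (g.pre_spec (O := noOracle) hF).exists_exec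
  obtain ⟨dh, hhalt, hout⟩ := (outputsWithin_iff_exists_haltsWithin _ _ _ _ _ _ _).1 hM
  have hst₁ : st₁ = ⟨g.finMem, []⟩ := by cases st₁; simp only at hmem hqs; rw [hmem, hqs]
  subst hst₁
  have key := outputsWithin_withSubrun (O := noOracle) zeroCoins (pre := pre g.kF g.cM)
    (post := CliqueRed.post) (L := lay) (E := g.env) (VT := 2 ^ W - 1) (V := g.V) (M := M)
    (x := g.x) (y := g.y) (out := [bit]) (T₂ := 3) hF.width hexec (g.envOK hF) (by omega) (by omega)
    (fun r hr => by
      simp only [lay, Layout.regs, List.mem_cons, List.not_mem_nil, or_false] at hr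
      rcases hr with rfl | rfl | rfl | rfl | rfl | rfl | rfl <;> omega)
    hdet hof (by rw [hcM]; exact hcMV) (by show g.V < g.V + 1; omega) (by omega)
    (by show 2 ^ g.ws - 1 ≤ g.V; have := g.le_V; unfold Pw at this; omega) (by omega)
    (g.tinv_finMem hF) (g.agree_finMem hF) hhalt
    (fun m₂ hag hI _ => by
      have := g.post_spec (O := noOracle) hF hag hI []
      rwa [CliqueRed.mem_one_of_readOut hout] at this)
  exact key.mono (by unfold Ttotal; have := ht₁; omega)

/-! ### The emulated word size is the decider's own -/

/-- `foldr max` is bounded by a common bound of the base and the members. [folklore] -/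
theorem foldr_max_le {l : List ℕ} {b B : ℕ} (hb : b ≤ B) (h : ∀ v ∈ l, v ≤ B) : l.foldr max b ≤ B := by
  induction l with
  | nil => simpa using hb
  | cons a l ih =>
    rw [List.foldr_cons]
    exact max_le (h a (by simp)) (ih fun v hv => h v (by simp [hv]))

/-- Every coordinate word of the two curves is at most `7806`. [folklore] -/
theorem ptWords_le {p : ℤ × ℤ} (hp : p ∈ curveP₁ g.φ g.n₁ ++ curveP₂ g.φ g.n₁ g.n₂) :
    ∀ v ∈ ptWords p, v ≤ 7806 := by
  obtain ⟨vs₁, vr₁, vt₁, vs₂, vs₂', vr₂, vt₂', vt₂, vc₁, vc₂⟩ := ptWords_vals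
  rcases List.mem_append.1 hp with hp | hp
  · rcases isQ₁_of_mem_curveP₁ hp with rfl | rfl | rfl | ⟨e, b, he, rfl⟩
    · rw [vs₁]; intro v hv; simp at hv; omega
    · rw [vt₁]; intro v hv; simp at hv; omega
    · rw [vr₁]; intro v hv; simp at hv; omega
    · rw [vc₁]; intro v hv; simp at hv
      have := Bool.toNat_le b
      rcases hv with rfl | rfl <;> omega
  · simp only [curveP₂, List.mem_cons, List.mem_append, List.not_mem_nil, or_false] at hp
    rcases hp with rfl | rfl | hp | rfl | rfl
    · rw [vs₂]; intro v hv; simp at hv; omega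
    · rw [vs₂']; intro v hv; simp at hv; omega
    · rcases isGadget₂_of_mem_gadgets₂ hp with rfl | ⟨e, b, he, rfl⟩
      · rw [vr₂]; intro v hv; simp at hv; omega
      · rw [vc₂]; intro v hv; simp at hv
        have := Bool.toNat_le b
        rcases hv with rfl | rfl <;> omega
    · rw [vt₂']; intro v hv; simp at hv; omega
    · rw [vt₂]; intro v hv; simp at hv; omega

/-- **The input width of the emulated input** is the bit size of `max |y| 9·10⁶`, the value the
program computes (`wv`); so the emulated word size `ws` is the decider's own `kF · width`.
[folklore] -/
theorem inputWidth_y : inputWidth g.y = Nat.size g.wv := by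
  have hfold : (((curveP₁ g.φ g.n₁ ++ curveP₂ g.φ g.n₁ g.n₂).flatMap ptWords).foldr max 1) ≤ 7806 := by
    refine foldr_max_le (by norm_num) fun v hv => ?_
    obtain ⟨p, hp, hv⟩ := List.mem_flatMap.1 hv
    exact g.ptWords_le hp v hv
  unfold inputWidth wv
  congr 1
  rw [g.length_y]
  conv_lhs => rw [y_eq, List.foldr_cons, List.foldr_cons, ← L₁_eq]
  rw [max_eq_left (a := 9000000) (by omega), ← max_assoc, max_eq_left (a := g.Ly)]
  have := g.lengths; omega

/-! ### The word size fits -/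

/-- **The word size fits.** The run at word size `kfit · (n + inputWidth x)` satisfies `Fits`.
[folklore] -/
theorem fits : g.Fits (kfit g.kF g.cM * (g.n + inputWidth g.x)) := by
  -- notation
  set n := g.n with hn
  set w := inputWidth g.x with hw
  set S := Nat.size g.cM with hS
  set A := 30 * (n + w) * g.kF with hA
  have hw1 : 1 ≤ w := inputWidth_pos _
  have hLx : g.Lx < 2 ^ w := length_lt_two_pow_inputWidth _
  obtain ⟨hX, hV0, hBv, hSv⟩ := g.bases
  obtain ⟨hL₁, hL₂, hLy, hN₁, hN₂, hPw1⟩ := g.lengths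
  obtain ⟨hn12, hn₁₂⟩ := g.n_eq
  have hmLx := g.m_add_two_le_Lx
  have h2 : ∀ {s t : ℕ}, s ≤ t → 2 ^ s ≤ 2 ^ t := fun h => Nat.pow_le_pow_right Nat.two_pos h
  -- the lengths
  have hN₂n : g.N₂ ≤ 2 ^ n := h2 (by rw [hn]; unfold n₂; omega)
  have hN₁n : g.N₁ ≤ 2 ^ n := (h2 hn₁₂).trans hN₂n
  have hnw : 2 ^ (n + w) = 2 ^ n * 2 ^ w := Nat.pow_add _ _ _
  have hL₁b : g.L₁ ≤ 2 ^ (n + w) := by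
    rw [hL₁, hnw]; exact Nat.mul_le_mul hN₁n (by omega)
  have hL₂b : g.L₂ ≤ 2 ^ (n + w) + 4 := by
    rw [hL₂, hnw]; exact Nat.add_le_add_right (Nat.mul_le_mul hN₂n (by omega)) 4
  have h8 : 8 ≤ 2 ^ (n + w + 2) := by
    calc (8 : ℕ) = 2 ^ 3 := rfl
      _ ≤ 2 ^ (n + w + 2) := h2 (by omega)
  have hLyb : g.Ly ≤ 2 ^ (n + w + 4) := by
    have e1 : 2 ^ (n + w + 4) = 2 ^ (n + w + 2) * 4 := by
      rw [show n + w + 4 = (n + w + 2) + 2 by omega, Nat.pow_add]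
    have e2 : 2 ^ (n + w + 2) = 2 ^ (n + w) * 4 := by rw [Nat.pow_add]
    omega
  -- wv, ws
  have hwv : g.wv < 2 ^ (n + w + 29) := by
    have e1 : 2 ^ (n + w + 4) < 2 ^ (n + w + 29) := Nat.pow_lt_pow_right (by norm_num) (by omega)
    have e2 : (9000000 : ℕ) < 2 ^ 24 := by norm_num
    have e3 : 2 ^ 24 ≤ 2 ^ (n + w + 29) := h2 (by omega)
    unfold wv; exact max_lt (by omega) (by omega)
  have hsize : Nat.size g.wv ≤ n + w + 29 := Nat.size_le.2 hwv
  have hws : g.ws ≤ A := by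
    unfold ws; rw [hA]
    exact Nat.mul_le_mul_right _ (hsize.trans (by omega))
  -- V
  have hcM : g.cM < 2 ^ S := Nat.lt_size_self _
  have hV : g.V ≤ 2 ^ A + 2 ^ S + 2 ^ (n + w + 4) := by
    have : g.Pw ≤ 2 ^ A := h2 hws
    unfold V; omega
  -- the exponent
  set E := A + S + (n + w + 8) with hE
  have eBv : g.Bv ≤ 2 ^ E := by
    have : 2 ^ (w + 8) = 2 ^ w * 256 := by rw [Nat.pow_add]
    have : 2 ^ (w + 8) ≤ 2 ^ E := h2 (by omega)
    unfold Bv X; omega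
  have eA : 2 ^ A ≤ 2 ^ E := h2 (by omega)
  have eS : 2 ^ S ≤ 2 ^ E := h2 (by omega)
  have eL : 2 ^ (n + w + 4) ≤ 2 ^ E := h2 (by omega)
  have e1 : 1 ≤ 2 ^ E := Nat.one_le_two_pow
  have htot : g.Sv + g.V + 1 ≤ 2 ^ (E + 3) := by
    have : 2 ^ (E + 3) = 2 ^ E * 8 := by rw [Nat.pow_add]
    rw [← hSv]; omega
  -- the word size
  have hkfit : kfit g.kF g.cM * (n + w) = A + S * (n + w) + 40 * (n + w) := by
    unfold kfit; rw [hA, hS]; ring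
  have hSnw : S ≤ S * (n + w) := Nat.le_mul_of_pos_right _ (by omega)
  have hW : E + 4 ≤ kfit g.kF g.cM * (n + w) := by rw [hkfit, hE]; omega
  refine ⟨htot.trans (h2 (by omega)), by omega, by omega, ?_, by omega⟩
  show w ≤ kfit g.kF g.cM * (n + w); omega

/-! ### The running time of the build -/

/-- **The running time of the build**: `O((Lx + 2)² (N₁ + N₂))`. [folklore] -/
theorem Tpre_le : g.Tpre ≤ 40 * ((g.Lx + 2) * (g.Lx + 2) * (g.N₁ + g.N₂)) + 40000000 := by
  obtain ⟨hL₁, hL₂, hLy, hN₁, hN₂, hPw1⟩ := g.lengths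
  have hmLx := g.m_add_two_le_Lx
  set P := (g.Lx + 2) * (g.Lx + 2) with hP
  have hPQ : P * (g.N₁ + g.N₂) = P * g.N₁ + P * g.N₂ := Nat.mul_add _ _ _
  have hPLx : g.Lx + 2 ≤ P := by rw [hP]; exact Nat.le_mul_of_pos_right _ (by omega)
  -- the blocks
  have hbA : g.TblockA + 2 ≤ 18 * P := by unfold TblockA; rw [hP]; nlinarith
  have hbB : g.TblockB + 2 ≤ 18 * P := by unfold TblockB; rw [hP]; nlinarith
  have hcA : g.N₁ * (g.TblockA + 2) ≤ 18 * (P * g.N₁) := by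
    calc g.N₁ * (g.TblockA + 2) ≤ g.N₁ * (18 * P) := Nat.mul_le_mul_left _ hbA
      _ = 18 * (P * g.N₁) := by ring
  have hcB : g.N₂ * (g.TblockB + 2) ≤ 18 * (P * g.N₂) := by
    calc g.N₂ * (g.TblockB + 2) ≤ g.N₂ * (18 * P) := Nat.mul_le_mul_left _ hbB
      _ = 18 * (P * g.N₂) := by ring
  -- the width value
  have hsz : Nat.size g.wv ≤ g.Ly + 9000000 := (CliqueRed.size_le_self _).trans (by
    unfold wv; exact max_le (Nat.le_add_right _ _) (Nat.le_add_left _ _))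
  have hLyb : g.Ly ≤ 2 * (P * g.N₁) + 2 * (P * g.N₂) + 10 := by
    have e1 : g.N₁ * (g.m + 3) ≤ P * g.N₁ := by
      rw [Nat.mul_comm P]; exact Nat.mul_le_mul_left _ (by omega)
    have e2 : g.N₂ * (g.m + 1) ≤ P * g.N₂ := by
      rw [Nat.mul_comm P]; exact Nat.mul_le_mul_left _ (by omega)
    omega
  have hLxP : g.Lx ≤ P * g.N₁ :=
    (show g.Lx ≤ P by omega).trans (Nat.le_mul_of_pos_right _ hN₁)
  unfold Tpre Tcurve₁ Tcurve₂
  omega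

/-! ### Polynomials against exponentials -/

/-- Powers are dominated by every exponential: `(n + 1)^d ≤ C · 2^{η n}`. [folklore] -/
theorem exists_pow_le_two_rpow (d : ℕ) {η : ℝ} (hη : 0 < η) :
    ∃ C : ℝ, 0 ≤ C ∧ ∀ n : ℕ, ((n : ℝ) + 1) ^ d ≤ C * (2 : ℝ) ^ (η * n) := by
  set r : ℝ := (2 : ℝ) ^ η with hr
  have hr1 : 1 < r := Real.one_lt_rpow (by norm_num) hη
  have hr0 : 0 < r := by linarith
  have ht := tendsto_pow_const_div_const_pow_of_one_lt d hr1
  obtain ⟨B, hB⟩ := ht.bddAbove_range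
  have hBn : ∀ n : ℕ, (n : ℝ) ^ d / r ^ n ≤ B := fun n => hB ⟨n, rfl⟩
  have hB0 : 0 ≤ B := le_trans (by positivity) (hBn 1)
  refine ⟨B * r, by positivity, fun n => ?_⟩
  have hrn : 0 < r ^ (n + 1) := pow_pos hr0 _
  have h1 : ((n : ℝ) + 1) ^ d ≤ B * r ^ (n + 1) := by
    have := hBn (n + 1); rw [div_le_iff₀ hrn] at this; push_cast at this; exact this
  have h2 : (2 : ℝ) ^ (η * n) = r ^ n := by rw [hr, Real.rpow_mul_natCast (by norm_num)]
  rw [h2]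
  calc ((n : ℝ) + 1) ^ d ≤ B * r ^ (n + 1) := h1
    _ = B * r * r ^ n := by ring

/-! ### The time of the whole reduction, in real terms -/

/-- The input length of a `k`-CNF without repeated clauses: `Lx + 6 ≤ (k + 9) (2 (n + 1))^{k+1}`.
[folklore] -/
theorem Lx_le {k : ℕ} (hw : g.φ.IsWidthLE k) (hnd : g.φ.Nodup) :
    g.Lx + 6 ≤ (k + 9) * (2 * (g.n + 1)) ^ (k + 1) := by
  have hm := numClauses_le_of_nodup hw hnd
  have hs := size_le_of_isWidthLE hw
  have hLx : g.Lx = 2 + g.φ.numClauses + g.φ.size := by unfold Lx x; rw [length_encodeCNFWords_eq]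
  set X := (2 * (g.φ.numVars + 1)) ^ (k + 1) with hX
  have h1 : 1 ≤ X := Nat.one_le_pow _ _ (by omega)
  have h2 : g.φ.size ≤ X * k := hs.trans (Nat.mul_le_mul_right _ hm)
  show g.Lx + 6 ≤ (k + 9) * X
  rw [hLx]; nlinarith

/-- **The running time of the reduction in real terms**: for `0 < ε ≤ 1`, the build plus `38`
emulated steps per step of a `⌊C (|P₁| + |P₂|)^{2-ε} + C⌋`-time decider costs at most
`(160 + 304 C) (Lx + 6)² · 2^{(1-ε/2) n} + 38 C + 4·10⁷ + 4`. [folklore] -/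
theorem Ttotal_real_le {ε C : ℝ} (hε : 0 < ε) (hε1 : ε ≤ 1) (hC : 0 ≤ C) :
    (g.Ttotal ⌊C * ((g.L₁ + g.L₂ : ℕ) : ℝ) ^ (2 - ε) + C⌋₊ : ℝ) ≤
      (160 + 304 * C) * ((g.Lx : ℝ) + 6) ^ 2 * (2 : ℝ) ^ ((1 - ε / 2) * g.n) + 38 * C +
        40000004 := by
  obtain ⟨hL₁, hL₂, hLy, hN₁, hN₂, hPw1⟩ := g.lengths
  obtain ⟨hn12, hn₁₂⟩ := g.n_eq
  have hmLx := g.m_add_two_le_Lx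
  set n := g.n with hn
  set a : ℝ := (2 : ℝ) ^ ((1 - ε / 2) * n) with ha
  have hn0 : (0 : ℝ) ≤ n := Nat.cast_nonneg _
  have hexp0 : 0 ≤ 1 - ε / 2 := by linarith
  have ha1 : 1 ≤ a := Real.one_le_rpow (by norm_num) (by positivity)
  -- N₁ + N₂ ≤ 2^{n₂ + 1} and 2^{n₂} ≤ 2 · a
  have hQ : g.N₁ + g.N₂ ≤ 2 ^ (g.n₂ + 1) := by
    have : g.N₁ ≤ g.N₂ := Nat.pow_le_pow_right Nat.two_pos hn₁₂
    unfold N₂ at *; rw [Nat.pow_succ]; omega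
  have hn₂ : (g.n₂ : ℝ) ≤ ((n : ℝ) + 1) / 2 := by
    have hn₁d : g.n₁ = n / 2 := rfl
    have : 2 * g.n₂ ≤ n + 1 := by omega
    have : ((2 * g.n₂ : ℕ) : ℝ) ≤ ((n + 1 : ℕ) : ℝ) := by exact_mod_cast this
    push_cast at this; linarith
  have h2n₂ : (2 : ℝ) ^ (g.n₂ : ℝ) ≤ 2 * a := by
    calc (2 : ℝ) ^ (g.n₂ : ℝ) ≤ (2 : ℝ) ^ (((n : ℝ) + 1) / 2) :=
          Real.rpow_le_rpow_of_exponent_le one_le_two hn₂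
      _ ≤ (2 : ℝ) ^ (1 + (1 - ε / 2) * n) :=
          Real.rpow_le_rpow_of_exponent_le one_le_two (by nlinarith)
      _ = 2 * a := by rw [Real.rpow_add (by norm_num), Real.rpow_one, ha]
  have hQr : ((g.N₁ + g.N₂ : ℕ) : ℝ) ≤ 4 * a := by
    calc ((g.N₁ + g.N₂ : ℕ) : ℝ) ≤ ((2 ^ (g.n₂ + 1) : ℕ) : ℝ) := by exact_mod_cast hQ
      _ = 2 * (2 : ℝ) ^ (g.n₂ : ℝ) := by rw [Real.rpow_natCast]; push_cast; ring
      _ ≤ 4 * a := by linarith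
  -- the instance size
  set L : ℝ := (g.Lx : ℝ) + 6 with hL
  have hL1 : 1 ≤ L := by rw [hL]; have : (0 : ℝ) ≤ g.Lx := Nat.cast_nonneg _; linarith
  have hN₂r : (2 : ℝ) ^ (g.n₂ : ℝ) = (g.N₂ : ℝ) := by rw [Real.rpow_natCast]; unfold N₂; push_cast; ring
  have hs : ((g.L₁ + g.L₂ : ℕ) : ℝ) ≤ (2 : ℝ) ^ (g.n₂ : ℝ) * (2 * L) := by
    have hN12 : g.N₁ ≤ g.N₂ := Nat.pow_le_pow_right Nat.two_pos hn₁₂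
    have e1a : g.N₁ * (g.m + 3) ≤ g.N₂ * (g.Lx + 1) := Nat.mul_le_mul hN12 (by omega)
    have e1b : g.N₂ * (g.m + 1) ≤ g.N₂ * (g.Lx + 1) := Nat.mul_le_mul_left _ (by omega)
    have e1 : g.L₁ + g.L₂ ≤ g.N₂ * (2 * (g.Lx + 6)) := by rw [hL₁, hL₂]; nlinarith [e1a, e1b, hN₂]
    calc ((g.L₁ + g.L₂ : ℕ) : ℝ) ≤ ((g.N₂ * (2 * (g.Lx + 6)) : ℕ) : ℝ) := by exact_mod_cast e1
      _ = (2 : ℝ) ^ (g.n₂ : ℝ) * (2 * L) := by rw [hN₂r, hL]; push_cast; ring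
  have hs0 : (0 : ℝ) ≤ ((g.L₁ + g.L₂ : ℕ) : ℝ) := Nat.cast_nonneg _
  have h2n₂' : ((2 : ℝ) ^ (g.n₂ : ℝ)) ^ (2 - ε) ≤ 2 * a := by
    rw [← Real.rpow_mul (by norm_num)]
    calc (2 : ℝ) ^ ((g.n₂ : ℝ) * (2 - ε)) ≤ (2 : ℝ) ^ (1 + (1 - ε / 2) * n) :=
          Real.rpow_le_rpow_of_exponent_le one_le_two (by nlinarith)
      _ = 2 * a := by rw [Real.rpow_add (by norm_num), Real.rpow_one, ha]
  have hpow : ((g.L₁ + g.L₂ : ℕ) : ℝ) ^ (2 - ε) ≤ 8 * a * L ^ 2 := by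
    have e0 : (0 : ℝ) ≤ 2 - ε := by linarith
    calc ((g.L₁ + g.L₂ : ℕ) : ℝ) ^ (2 - ε) ≤ ((2 : ℝ) ^ (g.n₂ : ℝ) * (2 * L)) ^ (2 - ε) :=
          Real.rpow_le_rpow hs0 hs e0
      _ = ((2 : ℝ) ^ (g.n₂ : ℝ)) ^ (2 - ε) * (2 * L) ^ (2 - ε) :=
          Real.mul_rpow (by positivity) (by positivity)
      _ ≤ (2 * a) * (2 * L) ^ (2 : ℝ) :=
          mul_le_mul h2n₂' (Real.rpow_le_rpow_of_exponent_le (by linarith) (by linarith))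
            (by positivity) (by positivity)
      _ = 8 * a * L ^ 2 := by rw [Real.rpow_two]; ring
  -- the decider's time
  set T := ⌊C * ((g.L₁ + g.L₂ : ℕ) : ℝ) ^ (2 - ε) + C⌋₊ with hT
  have hTr : (T : ℝ) ≤ C * (8 * a * L ^ 2) + C := by
    calc (T : ℝ) ≤ C * ((g.L₁ + g.L₂ : ℕ) : ℝ) ^ (2 - ε) + C := Nat.floor_le (by positivity)
      _ ≤ C * (8 * a * L ^ 2) + C := by gcongr
  -- the build
  have hpre := g.Tpre_le
  have hP : ((g.Lx : ℝ) + 2) * ((g.Lx : ℝ) + 2) * ((g.N₁ : ℝ) + g.N₂) ≤ L ^ 2 * (4 * a) := by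
    have e1 : ((g.Lx : ℝ) + 2) * ((g.Lx : ℝ) + 2) ≤ L ^ 2 := by rw [hL]; nlinarith
    have e2 : ((g.N₁ : ℝ) + g.N₂) ≤ 4 * a := by exact_mod_cast hQr
    have e3 : (0 : ℝ) ≤ (g.N₁ : ℝ) + g.N₂ := by positivity
    calc ((g.Lx : ℝ) + 2) * ((g.Lx : ℝ) + 2) * ((g.N₁ : ℝ) + g.N₂) ≤ L ^ 2 * ((g.N₁ : ℝ) + g.N₂) := by
          gcongr
      _ ≤ L ^ 2 * (4 * a) := by gcongr
  have hpreR : (g.Tpre : ℝ) ≤ 40 * (L ^ 2 * (4 * a)) + 40000000 := by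
    calc (g.Tpre : ℝ) ≤ ((40 * ((g.Lx + 2) * (g.Lx + 2) * (g.N₁ + g.N₂)) + 40000000 : ℕ) : ℝ) := by
          exact_mod_cast hpre
      _ ≤ 40 * (L ^ 2 * (4 * a)) + 40000000 := by push_cast; linarith
  -- assemble
  unfold Ttotal
  push_cast
  have hcs : (cstep : ℝ) = 38 := by norm_num [cstep]
  rw [hcs]
  nlinarith [hTr, hpreR, sq_nonneg L, ha1]


end Params

/-! ### The named fact and the target -/

set_option maxHeartbeats 800000 in
/-- **Bringmann's reduction from CNF-SAT to the discrete Fréchet decision problem, on the word RAM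
(proved).** If for some `0 < ε ≤ 1` the decision version of the discrete Fréchet distance of two
planar integer point sequences of total length `n` (`DiscreteFrechetDecision`: "is
`d_dF(P, Q) ≤ √τ²`?") has a deterministic `O(n^{2-ε})`-time word-RAM algorithm, then for every
width `k` and every exponent `δ > 1 - ε/2`, `k`-SAT (`kSATProblem k`: width `≤ k`, no repeated
clause, size `n` = number of variables) is decided on the deterministic word RAM in time
`O(2^{δ n})` (`KSATInRAMTime k δ`). Printed form (Bringmann, FOCS 2014, §3.1, "Proof of Thm. 1.1,
discrete case", with Lemmas 3.4–3.5 for correctness): for a CNF `φ` on `N` variables and `M`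
clauses the curves `P₁, P₂` of §3.1 have `n = O(M · 2^{N/2})` vertices, can be constructed in
time `O(N M 2^{N/2})`, and satisfy `d_dF(P₁, P₂) ≤ 1` iff `φ` is satisfiable; "if such an
algorithm runs in time `O(n^{2-δ})` for any small `δ > 0`, then the resulting algorithm runs in
time `O(M² 2^{(1-δ/2)N})`". The word-RAM reading proved here: the instance has integer coordinates
(the construction scaled by `3000`, threshold `τ² = 3000²`, `…BringmannCurves`), the decider is run
once, emulated at its own word size in relocated memory, and for the instances of `kSATProblem k`
one has `M ≤ (2(N+1))^{k+1}`, so the factors `M²`, `N` are absorbed by any exponent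
`δ > 1 - ε/2` (there is no `poly` factor in `KSATInRAMTime`); `ε ≤ 1` only excludes sub-linear
"deciders". The proof: run the reduction program
(`reduction_outputsWithin`) — relocation, the two curves of Bringmann's instance with integer
coordinates (`d_dF(P₁, P₂) ≤ 3000` iff `φ` is satisfiable, `good_frechetInstance_iff`), one
emulated run of the decider at its own word size (`inputWidth_y`), read-out — at word size
`kfit · (n + width)` (`fits`); the build costs `O((Lx + 6)² 2^{n/2})` and the emulated run
`38 (C (|P₁| + |P₂|)^{2-ε} + C) = O((Lx + 6)² 2^{(1-ε/2) n})` (`Ttotal_real_le`), and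
`(Lx + 6)² ≤ (k + 9)² 4^{k+1} (n + 1)^{2k+2}` for `k`-CNFs without repeated clauses (`Lx_le`) is
absorbed by `2^{(δ - (1 - ε/2)) n}` (`exists_pow_le_two_rpow`).
[cite: BringmannFOCS2014, §3.1 (Proof of Thm. 1.1, discrete case)] -/
theorem _root_.Literature.Computability.FineGrained.kSATInRAMTime_of_discreteFrechetDecision_inTimeO :
    ∀ ε : ℝ, 0 < ε → ε ≤ 1 →
      (DiscreteFrechetDecision.InTimeO fun n => (n : ℝ) ^ (2 - ε)) →
      ∀ (k : ℕ) (δ : ℝ), 1 - ε / 2 < δ → KSATInRAMTime k δ := by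
  classical
  intro ε hε hε1 hT k δ hδ
  obtain ⟨C, M, kF, hdet, hof, hM⟩ := hT
  -- the constants
  have hη : 0 < δ - (1 - ε / 2) := by linarith
  obtain ⟨C₃, hC₃, hpoly⟩ := Params.exists_pow_le_two_rpow (2 * k + 2) hη
  set cM := M.maxConst with hcM
  set C₀ : ℝ := max C 0 with hC₀
  have hC₀0 : 0 ≤ C₀ := le_max_right _ _
  have hCC₀ : C ≤ C₀ := le_max_left _ _
  set Dk : ℝ := ((k : ℝ) + 9) ^ 2 * (4 : ℝ) ^ (k + 1) with hDk
  set K : ℝ := (160 + 304 * C₀) * Dk * C₃ with hK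
  set Cbig : ℝ := K + (38 * C₀ + 40000004) with hCbig
  have hK0 : 0 ≤ K := by positivity
  refine ⟨reduction M kF, Params.kfit kF cM, Cbig, reduction_isDeterministic M kF,
    reduction_isOracleFree M kF, fun φ => ?_⟩
  -- one instance
  obtain ⟨hw, hnd⟩ := φ.2
  set g : Params := ⟨φ.1, kF, cM⟩ with hgdef
  have hsize : (kSATProblem k).size φ = g.n := rfl
  have hwidth : (kSATProblem k).width φ = inputWidth g.x := rfl
  have henc : (kSATProblem k).encode φ = g.x := rfl
  rw [hsize] 
  rw [hwidth, henc]
  have hF := g.fits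
  -- the decider on Bringmann's instance
  obtain ⟨out, hout, hMrun⟩ := hM g.inst
  have hn : g.φ.numVars ≤ g.n₁ + g.n₂ := le_of_eq g.n_eq.1
  have hgood : out = [if g.φ.Satisfiable then 1 else 0] :=
    (good_frechetInstance_iff (φ := g.φ) (n₁ := g.n₁) (n₂ := g.n₂) hn out).1 hout
  subst hgood
  have hws : kF * DiscreteFrechetDecision.width g.inst = g.ws := by
    show kF * inputWidth g.y = _
    rw [g.inputWidth_y]; unfold Params.ws; ring
  have hsz : DiscreteFrechetDecision.size g.inst = g.L₁ + g.L₂ := by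
    show DiscreteFrechetDecision.size (frechetInstance g.φ g.n₁ g.n₂) = _
    rw [size_frechetInstance]; rfl
  rw [hws] at hMrun
  dsimp only at hMrun
  rw [hsz] at hMrun
  change OutputsWithin M g.ws noOracle zeroCoins g.y _ _ at hMrun
  -- the constant made nonnegative
  have hMrun' : OutputsWithin M g.ws noOracle zeroCoins g.y [if g.φ.Satisfiable then 1 else 0]
      ⌊C₀ * ((g.L₁ + g.L₂ : ℕ) : ℝ) ^ (2 - ε) + C₀⌋₊ := by
    refine hMrun.mono (Nat.floor_le_floor ?_)
    have h0 : (0 : ℝ) ≤ ((g.L₁ + g.L₂ : ℕ) : ℝ) ^ (2 - ε) := by positivity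
    nlinarith [hCC₀, h0]
  have hred := g.reduction_outputsWithin hF hdet hof rfl hMrun'
  refine ⟨_, (OVRed.kSATProblem_good_iff k φ _).2 rfl, hred.mono ?_⟩
  -- the time bound
  set n := g.n with hndef
  apply Nat.le_floor
  have hB := g.Ttotal_real_le hε hε1 hC₀0
  have hLx := g.Lx_le hw hnd
  have hn0 : (0 : ℝ) ≤ n := Nat.cast_nonneg _
  have hpos : (0 : ℝ) ≤ (2 : ℝ) ^ (δ * n) := by positivity
  -- (Lx + 6)² ≤ Dk (n + 1)^{2k+2} ≤ Dk C₃ 2^{η n}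
  have hL : ((g.Lx : ℝ) + 6) ^ 2 ≤ Dk * (((n : ℝ) + 1) ^ (2 * k + 2)) := by
    have h1 : ((g.Lx : ℝ) + 6) ≤ ((k : ℝ) + 9) * (2 * ((n : ℝ) + 1)) ^ (k + 1) := by
      have := hLx
      have h' : ((g.Lx + 6 : ℕ) : ℝ) ≤ (((k + 9) * (2 * (g.n + 1)) ^ (k + 1) : ℕ) : ℝ) := by
        exact_mod_cast this
      push_cast at h'; rw [hndef]; exact h'
    have h0 : (0 : ℝ) ≤ (g.Lx : ℝ) + 6 := by positivity
    calc ((g.Lx : ℝ) + 6) ^ 2 ≤ (((k : ℝ) + 9) * (2 * ((n : ℝ) + 1)) ^ (k + 1)) ^ 2 := by gcongr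
      _ = Dk * ((n : ℝ) + 1) ^ (2 * k + 2) := by
          rw [hDk, mul_pow, mul_pow, mul_pow, ← pow_mul, ← pow_mul,
            show (4 : ℝ) = 2 ^ 2 by norm_num, ← pow_mul]
          ring_nf
  have hpn := hpoly n
  have hexp : (2 : ℝ) ^ ((1 - ε / 2) * n) * (2 : ℝ) ^ ((δ - (1 - ε / 2)) * n) = (2 : ℝ) ^ (δ * n) := by
    rw [← Real.rpow_add (by norm_num)]; ring_nf
  have hmain : (160 + 304 * C₀) * ((g.Lx : ℝ) + 6) ^ 2 * (2 : ℝ) ^ ((1 - ε / 2) * n) ≤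
      K * (2 : ℝ) ^ (δ * n) := by
    have e0 : (0 : ℝ) ≤ (2 : ℝ) ^ ((1 - ε / 2) * n) := by positivity
    calc (160 + 304 * C₀) * ((g.Lx : ℝ) + 6) ^ 2 * (2 : ℝ) ^ ((1 - ε / 2) * n)
        ≤ (160 + 304 * C₀) * (Dk * (C₃ * (2 : ℝ) ^ ((δ - (1 - ε / 2)) * n))) *
            (2 : ℝ) ^ ((1 - ε / 2) * n) := by
          gcongr
          exact hL.trans (by gcongr)
      _ = K * ((2 : ℝ) ^ ((1 - ε / 2) * n) * (2 : ℝ) ^ ((δ - (1 - ε / 2)) * n)) := by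
          rw [hK]; ring
      _ = K * (2 : ℝ) ^ (δ * n) := by rw [hexp]
  calc (g.Ttotal ⌊C₀ * ((g.L₁ + g.L₂ : ℕ) : ℝ) ^ (2 - ε) + C₀⌋₊ : ℝ)
      ≤ (160 + 304 * C₀) * ((g.Lx : ℝ) + 6) ^ 2 * (2 : ℝ) ^ ((1 - ε / 2) * n) + 38 * C₀ +
          40000004 := hB
    _ ≤ K * (2 : ℝ) ^ (δ * n) + (38 * C₀ + 40000004) := by linarith
    _ ≤ Cbig * (2 : ℝ) ^ (δ * n) + Cbig := by
        rw [hCbig]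
        have : (0 : ℝ) ≤ 38 * C₀ + 40000004 := by positivity
        nlinarith [hpos, this, hK0]

/-- **fine-grained.S15, discrete Fréchet (Bringmann, FOCS 2014, Thm. 1.1, discrete case), proved.**
Assuming word-RAM SETH, for every `ε > 0` the decision version of the discrete Fréchet distance of
two planar integer point sequences of total length `n` has no deterministic `O(n^{2-ε})`-time
word-RAM algorithm: if it had one, shrink `ε` to `ε₁ = min ε 1`; by Bringmann's reduction on the
word RAM (`kSATInRAMTime_of_discreteFrechetDecision_inTimeO`) `k`-SAT would be in word-RAM time
`O(2^{(1 - ε₁/4) n})` for *every* `k`, contradicting `SETHWordRAM` at `ε₁/4`.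
[cite: BringmannFOCS2014, Thm. 1.1 (discrete case)] -/
theorem _root_.Literature.Computability.FineGrained.not_discreteFrechetDecision_inTimeO_of_sethWordRAM_holds :
    not_discreteFrechetDecision_inTimeO_of_sethWordRAM := by
  intro hSETH ε hε hF
  set ε₁ : ℝ := min ε 1 with hε₁
  have hε₁pos : 0 < ε₁ := lt_min hε one_pos
  have hε₁le : ε₁ ≤ 1 := min_le_right _ _
  have hF₁ : DiscreteFrechetDecision.InTimeO fun n => (n : ℝ) ^ (2 - ε₁) :=
    inTimeO_rpow_two_sub_anti (min_le_left _ _) hF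
  obtain ⟨k, -, hk⟩ := hSETH (ε₁ / 4) (by positivity)
  exact hk (kSATInRAMTime_of_discreteFrechetDecision_inTimeO ε₁ hε₁pos hε₁le hF₁ k (1 - ε₁ / 4)
    (by linarith))

end FrechetRed

end Literature.Computability.FineGrained
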